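import Summits.QuantumFields.BalabanUV.T4Continuum.Support.NE9B11SolutionAnalytic
import Literature.MathematicalPhysics.QuantumFieldTheory.Balaban1983to89.B11Eq174Chart

/-!
# NE9B11ChartAnalytic — lit-balaban's CHART OBJECT `B11Eq174Chart.solA ∕ chartH ∕ chartHB` (p249182, the NEED-3(b) «ONE missing object»
# of INTERFACES §3) IS FRÉCHET-ANALYTIC IN THE BANACH DATUM and, with the Sect. C map (47) built from the SAME object, meets the `cur`
# species' background-map binders (Ψ1)–(Ψ3) (adapter of `NE9B11SolutionAnalytic` p249501 to the Literature object; route R2′ of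
# `t4/ROUTES-NE9.md` v2; cell `pub-balaban`, T4-DAG §2 node U3 ∕ §6 NE9; BINDER row NE9 OWNER lineage `b2b-balaban-t4-ne9-p1`, generation 59;
# Summits-side NEW work, nothing printed asserted)

HONEST FRAMING (T4-DAG PAGE 1).  Rung (B)+1 of the FINITE-VOLUME T⁴ programme — NOT infinite volume, NOT a mass gap, NOT the Clay
problem.  NE9 (`T4OutputRate.NE9` ∧ `FadingMemory`) is a cell NEW ESTIMATE, NOT PRINTED in [I] = [Balaban1987RG1] (CMP **109**), [II] =
[Balaban1988RG2Cluster] (CMP **116**), and NOT PROVED here («NE9 ⇐ the named binders»; spine PROVED 0∕9).  HONEST DEPENDENCY (cell line,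
verbatim): continuum YM on T⁴ ⇐ BetaPertH ∧ nine spine estimates (0/9 proved); BetaPertH ⇐ (D1) ∧ (D4) ∧ CAP+tail; G-an2-4 gates asym, D1
and NE2/3/4.  MECHANISM ONLY over the abstract scheme of `B11Prop6Scheme` ∕ `B11Eq174Chart` (every operator a DATUM, every bound and
smallness condition a HYPOTHESIS bundled in lit-balaban's `Regime`); nothing of [15] = [Balaban1985Variational] (CMP **102**) is asserted; no
lattice carrier is typed (route step B2′ = socket C19′, FROZEN under ruling e34b3e0c (0)).

WHY.  `B11Eq174Chart` (lit-balaban p07) types [15] Sect. G's chart as a Lean OBJECT: `solA 𝒢 Λ W J ε₄ 𝔄` (the selected solution of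
(175)∕(116)∕(143)∕(180) in the ball (115)), `chartH … T ε₄ 𝔄 = T(solA … 𝔄 + 𝔄)` ((174)∕(179)), `chartHB … H₁ B` (𝔄 = H₁B), and proves
p. 306's *«an analytic function of H₁B, hence of B»* along ONE-complex-parameter families (`Regime.solA_differentiableOn`,
`Regime.chartHB_differentiableOn_line`).  The NE9 END's species (a) consumes the chart through `NE9CurveFromBackgroundMap`, whose binder
(Ψ1) is FRÉCHET holomorphy on a ball of the Banach space of B-fields.  THIS FILE transfers `NE9B11SolutionAnalytic` (p249501) to the object:
* §1 **`solA_analyticOnNhd`** — under a `Regime` and `W` analytic on `{‖Y‖ < a₃}` (finite dimension: `Prop4Hyp`, §3), `𝔄 ↦ solA 𝒢 Λ W J ε₄ 𝔄`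
  is `AnalyticOnNhd ℂ` on `ball 0 a` (uniqueness in the ball identifies it with p249501's analytic section); `chartH_differentiableOn_ball`,
  **`chartHB_differentiableOn`** — (174) is Fréchet-holomorphic in `𝔄` on `ball 0 a`, and in `B` on `{B | ‖H₁B‖ < a}`.
* §2 **`chartHB_triple`** — (Ψ1)–(Ψ3) for `chartHB 𝒢 Λ W 0 T ε₄ H₁` on `ball 0 R → ball 0 R′` (`‖H₁B‖ < a` on the ball, `T` holomorphic and
  `K`-Lipschitz on `‖·‖ < ε₄ + a` with `T 0 = 0`, `K(ε₄ + a) ≤ R′`, `0 < R′`); **`chart47_spec`** — the Sect. C map (47) IS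
  `A′ ↦ A′ + solA H 0 C 0 ε_C A′` (the same object with `(𝒢, W) := (H, C)`: `X′ = −HD(A′)` solves `X′ = −H(C(X′ + A′))`): analytic on its
  ball, fixes `0`, second order, Lipschitz; **`chartHB_triple_of_twoRegimes`** — the two assembled: under a Sect. E∕G `Regime` and a Sect. C
  `Regime`, lit-balaban's `chartHB 𝒢 0 W 0 (fun A′ => A′ + solA H 0 C 0 ε_C A′) ε₄ H₁` satisfies (Ψ1)–(Ψ3).
* §3 finite dimension: `solA_analyticOnNhd_fd` from `Prop4Hyp` (Osgood).
DISGUISE TEST: identification by uniqueness + composition; no inequality of the series; not NE9; 0 def, 0 sorry.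

References (TYPES ∕ loci only): [Balaban1985Variational] T. Bałaban, CMP **102** (1985) 277–309, (47) p. 285, (55) p. 286, Prop. 3 p. 289,
Prop. 6 pp. 295–296, (172)–(175) p. 305, p. 306, Prop. 9 p. 309; [Balaban1987RG1] T. Bałaban, CMP **109** (1987), (3.27) p. 275, (3.37) p. 277,
Lemma 4 (3.53) p. 280.  Imports `NE9B11SolutionAnalytic` (p249501) and `B11Eq174Chart` (p249182) ONLY; modifies nothing; no END re-wired.
Value = the Literature chart object made consumable by the NE9 END's species (a), NOT summit progress.
-/

noncomputable section

open scoped Topology NNReal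
open Metric Set Filter

namespace Summit.QuantumFields.BalabanUV.T4Continuum.NE9B11ChartAnalytic

open Literature.MathematicalPhysics.QuantumFieldTheory.Balaban1983to89
open Literature.MathematicalPhysics.QuantumFieldTheory.Balaban1983to89.B13Contraction113 (QuadAnalytic)
open Literature.MathematicalPhysics.QuantumFieldTheory.Balaban1983to89.B11Prop6Scheme
open Literature.MathematicalPhysics.QuantumFieldTheory.Balaban1983to89.B11Eq174Chart
open Summit.QuantumFields.BalabanUV.T4Continuum.NE9B11SolutionAnalytic

variable {𝒴 𝒵 : Type*} [NormedAddCommGroup 𝒴] [NormedSpace ℂ 𝒴] [CompleteSpace 𝒴] [NormedAddCommGroup 𝒵] [NormedSpace ℂ 𝒵]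
variable {𝒢 : 𝒵 →L[ℂ] 𝒴} {Λ : 𝒴 →L[ℂ] 𝒴} {W : 𝒴 → 𝒵} {B₀ θ C₄ a₃ j a ε₄ : ℝ} {J : 𝒵}

/-! ## §1 The Literature solution operator and chart are Fréchet-analytic in the datum -/

/-- **lit-balaban's `solA` IS FRÉCHET-ANALYTIC IN THE BANACH DATUM** ([15] Prop. 6 p. 296 *«the solution is an analytic function of 𝔄»*,
p. 306 *«𝒜₁ … is an analytic function of H₁B, hence of B»* — Banach-parameter form): under `Regime 𝒢 Λ W B₀ θ C₄ a₃ j a ε₄`, `W` analytic on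
`{‖Y‖ < a₃}` and `‖J‖ ≤ j`, `AnalyticOnNhd ℂ (solA 𝒢 Λ W J ε₄) (ball 0 a)`.  Proof: p249501's analytic section IS `solA` on the ball by
uniqueness (`Regime.eq_solA`). [cite: Balaban1985Variational, Prop. 6 pp.295-296, p.306] -/
theorem solA_analyticOnNhd (R : Regime 𝒢 Λ W B₀ θ C₄ a₃ j a ε₄) (hWa : AnalyticOnNhd ℂ W {Y : 𝒴 | ‖Y‖ < a₃}) (hJ : ‖J‖ ≤ j) :
    AnalyticOnNhd ℂ (solA 𝒢 Λ W J ε₄) (ball (0 : 𝒴) a) := by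
  obtain ⟨Xs, hXa, hXs⟩ := exists_analyticOnNhd_solution R.norm_G R.norm_L R.quad hWa R.B₀_nonneg R.C₄_nonneg R.θ_nonneg hJ
    R.ε₄_nonneg R.dom R.self R.contr
  intro 𝔄₀ h𝔄₀
  refine (hXa 𝔄₀ h𝔄₀).congr ?_
  filter_upwards [isOpen_ball.mem_nhds h𝔄₀] with 𝔄 h𝔄
  exact R.eq_solA hJ (mem_ball_zero_iff.1 h𝔄) (hXs 𝔄 h𝔄).1 (hXs 𝔄 h𝔄).2.1

/-- `solA` is Fréchet-`DifferentiableOn ℂ` on the datum ball. [cite: Balaban1985Variational, Prop. 6 p.296] -/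
theorem solA_differentiableOn_ball (R : Regime 𝒢 Λ W B₀ θ C₄ a₃ j a ε₄) (hWa : AnalyticOnNhd ℂ W {Y : 𝒴 | ‖Y‖ < a₃})
    (hJ : ‖J‖ ≤ j) : DifferentiableOn ℂ (solA 𝒢 Λ W J ε₄) (ball (0 : 𝒴) a) :=
  (solA_analyticOnNhd R hWa hJ).differentiableOn

/-- **(174) IS FRÉCHET-HOLOMORPHIC IN THE DATUM `𝔄`** on `ball 0 a`, for `T` (the Sect. C map (47), a DATUM here) holomorphic on `‖·‖ < ε₄ + a`
([15] p. 305 *«The function on the right-hand side of (174) is an analytic function of 𝒜₁ + H₁B»*). [cite: Balaban1985Variational, (174) p.305] -/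
theorem chartH_differentiableOn_ball (R : Regime 𝒢 Λ W B₀ θ C₄ a₃ j a ε₄) (hWa : AnalyticOnNhd ℂ W {Y : 𝒴 | ‖Y‖ < a₃})
    (hJ : ‖J‖ ≤ j) {T : 𝒴 → 𝒴} (hT : DifferentiableOn ℂ T (ball (0 : 𝒴) (ε₄ + a))) :
    DifferentiableOn ℂ (chartH 𝒢 Λ W J T ε₄) (ball (0 : 𝒴) a) := by
  refine hT.comp ((solA_differentiableOn_ball R hWa hJ).add differentiableOn_id) fun 𝔄 h𝔄 => ?_
  rw [mem_ball_zero_iff]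
  exact norm_arg_lt (mem_ball_zero_iff.1 h𝔄) (R.solA_mem hJ (mem_ball_zero_iff.1 h𝔄)).1

/-- **«It is an analytic function of B» — FRÉCHET form** ([15] Prop. 9 p. 309): `B ↦ chartHB 𝒢 Λ W J T ε₄ H₁ B` is `DifferentiableOn ℂ` on the
open set `{B | ‖H₁B‖ < a}` of the Banach space of B-fields (not only along complex lines, cf. `Regime.chartHB_differentiableOn_line`).
[cite: Balaban1985Variational, Prop. 9 p.309, p.306] -/
theorem chartHB_differentiableOn (R : Regime 𝒢 Λ W B₀ θ C₄ a₃ j a ε₄) (hWa : AnalyticOnNhd ℂ W {Y : 𝒴 | ‖Y‖ < a₃})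
    (hJ : ‖J‖ ≤ j) {T : 𝒴 → 𝒴} (hT : DifferentiableOn ℂ T (ball (0 : 𝒴) (ε₄ + a))) {𝒳 : Type*} [NormedAddCommGroup 𝒳]
    [NormedSpace ℂ 𝒳] (H₁ : 𝒳 →L[ℂ] 𝒴) :
    DifferentiableOn ℂ (chartHB 𝒢 Λ W J T ε₄ H₁) {B : 𝒳 | ‖H₁ B‖ < a} :=
  (chartH_differentiableOn_ball R hWa hJ hT).comp H₁.differentiable.differentiableOn fun _ hB => mem_ball_zero_iff.2 hB

/-! ## §2 (Ψ1)–(Ψ3) for the Literature chart, and the Sect. C map (47) as the same object -/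

/-- **(Ψ1)–(Ψ3) FOR lit-balaban's `chartHB`** (`J = 0`), LITERALLY in `NE9CurveFromBackgroundMap`'s shapes: on a ball `‖B‖ < R` with `‖H₁B‖ < a`,
for `T` holomorphic and `K`-Lipschitz (`0 ≤ K`) on `‖·‖ < ε₄ + a` with `T 0 = 0`, and a chart radius `R′ > 0` with `K(ε₄ + a) ≤ R′`:
`DifferentiableOn ℂ (chartHB …) (ball 0 R)`, `MapsTo (chartHB …) (ball 0 R) (ball 0 R′)` (`Regime.norm_chartH_le`: ‖𝓗‖ ≤ K(ε₄ + ‖𝔄‖) — the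
norm form of «𝓗 satisfies (19)–(21)»), `chartHB … 0 = 0` (`Regime.chartH_zero`). [cite: Balaban1985Variational, (173)-(175) p.305, Prop. 9 p.309; Balaban1987RG1, (3.37) p.277, (3.53) p.280] -/
theorem chartHB_triple (R : Regime 𝒢 Λ W B₀ θ C₄ a₃ j a ε₄) (hWa : AnalyticOnNhd ℂ W {Y : 𝒴 | ‖Y‖ < a₃}) (hj : 0 ≤ j)
    (ha : 0 < a) {T : 𝒴 → 𝒴} (hTd : DifferentiableOn ℂ T (ball (0 : 𝒴) (ε₄ + a))) (hT0 : T 0 = 0) {K : ℝ} (hK : 0 ≤ K)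
    (hT : ∀ x y : 𝒴, ‖x‖ < ε₄ + a → ‖y‖ < ε₄ + a → ‖T x - T y‖ ≤ K * ‖x - y‖)
    {𝒳 : Type*} [NormedAddCommGroup 𝒳] [NormedSpace ℂ 𝒳] (H₁ : 𝒳 →L[ℂ] 𝒴) {R' Rb : ℝ} (hRb : ∀ B ∈ ball (0 : 𝒳) Rb, ‖H₁ B‖ < a)
    (hR'0 : 0 < R') (hR' : K * (ε₄ + a) ≤ R') :
    DifferentiableOn ℂ (chartHB 𝒢 Λ W 0 T ε₄ H₁) (ball (0 : 𝒳) Rb) ∧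
      MapsTo (chartHB 𝒢 Λ W 0 T ε₄ H₁) (ball (0 : 𝒳) Rb) (ball (0 : 𝒴) R') ∧ chartHB 𝒢 Λ W 0 T ε₄ H₁ 0 = 0 := by
  have hJ : ‖(0 : 𝒵)‖ ≤ j := by rw [norm_zero]; exact hj
  refine ⟨(chartHB_differentiableOn R hWa hJ hTd H₁).mono fun B hB => hRb B hB, fun B hB => ?_, ?_⟩
  · have hHa : ‖H₁ B‖ < a := hRb B hB
    have h := (R.norm_chartH_le (T := T) hJ hHa hK hT0 hT).2
    rw [mem_ball_zero_iff]
    show ‖chartH 𝒢 Λ W 0 T ε₄ (H₁ B)‖ < R'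
    rcases hK.eq_or_lt with hK0 | hKpos
    · rw [← hK0, zero_mul] at h; exact lt_of_le_of_lt h hR'0
    · exact lt_of_le_of_lt h ((mul_lt_mul_of_pos_left (by linarith) hKpos).trans_le hR')
  · show chartH 𝒢 Λ W 0 T ε₄ (H₁ 0) = 0
    rw [map_zero]; exact R.chartH_zero hj ha hT0

/-- **THE Sect. C MAP (47) IS THE SAME LITERATURE OBJECT**: with `(𝒢, W, Λ, J) := (H, C, 0, 0)` the unknown `X′ = −HD(A′)` of (50) solves
`X′ = mapT H 0 C 0 A′ X′ = −H(C(X′ + A′))`, so (47) `A = A′ − HD(A′)` is `A′ ↦ A′ + solA H 0 C 0 ε_C A′`.  Under a Sect. C regime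
`Regime H 0 C b 0 C₂ c₄ 0 a_C ε_C` with `C` analytic on `{‖Y‖ < c₄}`: this map is ANALYTIC on `ball 0 a_C`, fixes `0`, satisfies
`(T A′ − A′) = −H(C(T A′))` (i.e. `D(A′) = C(T A′)`), the second-order bound `‖T A′ − A′‖ ≤ bC₂(ε_C + a_C)²` ((55)-type;
`Regime.norm_solA_le_sq`) and the Lipschitz bound `‖T x − T y‖ ≤ ‖x − y‖∕(1 − 4bC₂(ε_C + a_C))` (`T4FixedPointResponse`).
[cite: Balaban1985Variational, (47) p.285, (54)-(55) p.286, Prop. 3 p.289] -/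
theorem chart47_spec {𝒳 : Type*} [NormedAddCommGroup 𝒳] [NormedSpace ℂ 𝒳] {H : 𝒳 →L[ℂ] 𝒴} {C : 𝒴 → 𝒳} {b C₂ c₄ aC εC : ℝ}
    (RC : Regime H 0 C b 0 C₂ c₄ 0 aC εC) (hCa : AnalyticOnNhd ℂ C {Y : 𝒴 | ‖Y‖ < c₄}) (haC : 0 < aC) :
    AnalyticOnNhd ℂ (fun A' : 𝒴 => A' + solA H 0 C 0 εC A') (ball (0 : 𝒴) aC) ∧
      (fun A' : 𝒴 => A' + solA H 0 C 0 εC A') 0 = 0 ∧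
      (∀ A' ∈ ball (0 : 𝒴) aC, (A' + solA H 0 C 0 εC A') - A' = -H (C (A' + solA H 0 C 0 εC A')) ∧
        ‖(A' + solA H 0 C 0 εC A') - A'‖ ≤ b * C₂ * (εC + aC) ^ 2) ∧
      ∀ x y : 𝒴, ‖x‖ < aC → ‖y‖ < aC →
        ‖(x + solA H 0 C 0 εC x) - (y + solA H 0 C 0 εC y)‖ ≤ 1 / (1 - 4 * b * C₂ * (εC + aC)) * ‖x - y‖ := by
  have hJ : ‖(0 : 𝒳)‖ ≤ 0 := by rw [norm_zero]
  refine ⟨analyticOnNhd_id.add (solA_analyticOnNhd RC hCa hJ), by simp only [RC.solA_zero le_rfl haC, add_zero],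
    fun A' hA' => ?_, fun x y hx hy => ?_⟩
  · have hm := RC.solA_mem hJ (mem_ball_zero_iff.1 hA')
    refine ⟨?_, ?_⟩
    · rw [add_sub_cancel_left, add_comm A']
      have h := hm.2
      rw [mapT_158] at h
      exact h.symm
    · rw [add_sub_cancel_left]; exact RC.norm_solA_le_sq le_rfl (mem_ball_zero_iff.1 hA')
  · have hmx := RC.solA_mem hJ hx
    have hmy := RC.solA_mem hJ hy
    have hcontr' : 0 + 4 * b * C₂ * (εC + aC) < 1 := RC.contr
    have h := T4FixedPointResponse.norm_solution_sub_le_data (J₁ := (0 : 𝒳)) (J₂ := (0 : 𝒳)) RC.norm_G RC.norm_L RC.quad RC.B₀_nonneg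
      RC.C₄_nonneg hx hy RC.ε₄_nonneg RC.dom RC.contr hmx.1 hmy.1 hmx.2 hmy.2
    have hsplit : x + solA H 0 C 0 εC x - (y + solA H 0 C 0 εC y) = (x - y) + (solA H 0 C 0 εC x - solA H 0 C 0 εC y) := by abel
    rw [hsplit]
    refine (norm_add_le _ _).trans (add_le_div_one_sub (by linarith) ?_)
    simpa using h

/-- **ROUTE R2′ ON lit-balaban's OBJECT: (174) ∘ (175) ∘ (47) ∘ (50) MEETS (Ψ1)–(Ψ3).**  Under a Sect. E∕G regime `Regime 𝒢 Λ W B₀ θ C₄ a₃ j a ε₄`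
(`W` analytic on its ball, `0 ≤ j`, `0 < a`), a Sect. C regime `Regime H 0 C b 0 C₂ c₄ 0 a_C ε_C` (`C` analytic on its ball,
`ε₄ + a ≤ a_C`), `H₁` with `‖H₁B‖ < a` on `‖B‖ < R_b`, and a chart radius `R′ > 0` with `(ε₄ + a)∕(1 − 4bC₂(ε_C + a_C)) ≤ R′`: the map
`chartHB 𝒢 Λ W 0 (fun A′ => A′ + solA H 0 C 0 ε_C A′) ε₄ H₁` is `DifferentiableOn ℂ` on `ball 0 R_b`, maps it into `ball 0 R′`, and vanishes
at `0` — the three background-map binders of `NE9CurveFromBackgroundMap` for Bałaban's chart as typed by lit-balaban.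
[cite: Balaban1985Variational, (47) p.285, Prop. 6 pp.295-296, (172)-(175) p.305, Prop. 9 p.309; Balaban1987RG1, (3.37) p.277, (3.53) p.280] -/
theorem chartHB_triple_of_twoRegimes (R : Regime 𝒢 Λ W B₀ θ C₄ a₃ j a ε₄) (hWa : AnalyticOnNhd ℂ W {Y : 𝒴 | ‖Y‖ < a₃})
    (hj : 0 ≤ j) (ha : 0 < a) {𝒳 : Type*} [NormedAddCommGroup 𝒳] [NormedSpace ℂ 𝒳] {H : 𝒳 →L[ℂ] 𝒴} {C : 𝒴 → 𝒳}
    {b C₂ c₄ aC εC : ℝ} (RC : Regime H 0 C b 0 C₂ c₄ 0 aC εC) (hCa : AnalyticOnNhd ℂ C {Y : 𝒴 | ‖Y‖ < c₄}) (haCge : ε₄ + a ≤ aC)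
    {ℬ : Type*} [NormedAddCommGroup ℬ] [NormedSpace ℂ ℬ] (H₁ : ℬ →L[ℂ] 𝒴) {R' Rb : ℝ} (hRb : ∀ B ∈ ball (0 : ℬ) Rb, ‖H₁ B‖ < a)
    (hR'0 : 0 < R') (hR' : 1 / (1 - 4 * b * C₂ * (εC + aC)) * (ε₄ + a) ≤ R') :
    DifferentiableOn ℂ (chartHB 𝒢 Λ W 0 (fun A' : 𝒴 => A' + solA H 0 C 0 εC A') ε₄ H₁) (ball (0 : ℬ) Rb) ∧
      MapsTo (chartHB 𝒢 Λ W 0 (fun A' : 𝒴 => A' + solA H 0 C 0 εC A') ε₄ H₁) (ball (0 : ℬ) Rb) (ball (0 : 𝒴) R') ∧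
      chartHB 𝒢 Λ W 0 (fun A' : 𝒴 => A' + solA H 0 C 0 εC A') ε₄ H₁ 0 = 0 := by
  have hεa : 0 < ε₄ + a := by linarith [R.ε₄_nonneg]
  have haC : 0 < aC := lt_of_lt_of_le hεa haCge
  obtain ⟨hTa, hT0, -, hTlip⟩ := chart47_spec RC hCa haC
  have hq : 0 ≤ 1 / (1 - 4 * b * C₂ * (εC + aC)) := by
    have : 0 < 1 - 4 * b * C₂ * (εC + aC) := by linarith [RC.contr]
    positivity
  exact chartHB_triple R hWa hj ha (hTa.differentiableOn.mono (ball_subset_ball haCge)) hT0 hq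
    (fun x y hx hy => hTlip x y (lt_of_lt_of_le hx haCge) (lt_of_lt_of_le hy haCge)) H₁ hRb hR'0 hR'

/-! ## §3 Finite dimension -/

/-- **On finite-dimensional configuration spaces** (every lattice space of the series) §1–§2's analyticity hypothesis is lit-balaban's own
`Prop4Hyp` (Osgood): `AnalyticOnNhd ℂ (solA 𝒢 Λ W J ε₄) (ball 0 a)` under a `Regime`, `Prop4Hyp W C₄ a₃`, `‖J‖ ≤ j`.
[cite: Balaban1985Variational, Prop. 6 pp.295-296] -/
theorem solA_analyticOnNhd_fd [FiniteDimensional ℂ 𝒴] [CompleteSpace 𝒵] (R : Regime 𝒢 Λ W B₀ θ C₄ a₃ j a ε₄)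
    (hW : Prop4Hyp W C₄ a₃) (hJ : ‖J‖ ≤ j) : AnalyticOnNhd ℂ (solA 𝒢 Λ W J ε₄) (ball (0 : 𝒴) a) :=
  solA_analyticOnNhd R (analyticOnNhd_of_prop4Hyp hW) hJ

end Summit.QuantumFields.BalabanUV.T4Continuum.NE9B11ChartAnalytic

end
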